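import Summits.BirchSwinnertonDyer.BirchSwinnertonDyer.Theorems.SmallImageMuTransferMuTransferX9NormCompatibleIntegral
import Literature.NumberTheory.EllipticCurves.Kato2004.IwasawaH1ReductionRoots
import HarnessLib

/-!
# K6 crux `MuTransferX9` (stmt-BirchSwinnertonDyer-19276), skeleton v8 registered stub `stub_red`:
# F2 = `Kato2004.mem_pSmul_of_red_eq_zero` (Kato 2004, §13.8 "`𝐇¹(T)/p𝐇¹(T) ⊂ 𝐇¹(T/p)`" on the pin)
# is a THEOREM

Cell `bsd-smallim`, seat `bsd-smallim-k6-lur-a` (gen 2).  THEOREMS ONLY.  The registered stub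
`stub_red : mem_pSmul_of_red_eq_zero` of the deciding crux 19276 (skeleton v8: `stub_inputsX9 : F1`,
`stub_red : F2`) is proved by composing
* k6-g4's `Kato2004.mem_pSmul_of_red_eq_zero_of_integral_of_smul_mem` (levelwise kernel
  `reduceH1_eq_zero_iff` + norm-compatible `p`-th roots on the pin, `IwasawaH1ReductionRoots`), whose one
  hypothesis is the weak Lemma 8.5 (2) on the pin, with
* this seat's `UniversalNorms.mem_integralH1_of_layerCores_eq_of_smul_mem` (`…X9NormCompatibleIntegral`:
  a norm-compatible family along the cyclotomic `ℤ_p`-tower whose `p`-multiples are integral is integral).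
With F3 a tree theorem (bsd-cn100 `poitouTate_sum_localTatePairing_eq_zero_holds`, aside 19845 closed) the
deciding crux `MuTransferX9` now holds modulo F1 = `Kato2004.exists_divisibilityInputs_fineQuotient_zeta` only.

References: K. Kato, Astérisque 295 (2004), §13.8 (pp. 228–229), Lemma 8.5 (2) (p. 184)
[Kato2004Asterisque]; K. Rubin, *Euler Systems* (2000), App. B Prop. B.3.3 [Rubin2000].
-/

noncomputable section

open Literature.NumberTheory.EllipticCurves.Kato2004

set_option linter.dupNamespace false

namespace Summit.BirchSwinnertonDyer.BirchSwinnertonDyer.Rank1Residual.UniversalNorms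

/-- **F2 is a theorem: Kato 2004 §13.8 on the pin** — for every elliptic curve `W/ℚ`, prime `p`, cyclotomic
`κ` with topological generator `γ`, datum `I : IwasawaH1Data W p κ γ` and `x ∈ 𝐇¹_Γ(T_pW)` with vanishing
levelwise reductions `red x = 0`, `x ∈ p·𝐇¹` (the registered stub `stub_red` of crux 19276, = the named fact
`Kato2004.mem_pSmul_of_red_eq_zero` = aside 19844 `KatoReductionModPKernel`).
[cite: Kato2004Asterisque, §13.8 (pp. 228–229) with Lemma 8.5 (2) (p. 184)] -/
theorem stub_red : mem_pSmul_of_red_eq_zero :=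
  mem_pSmul_of_red_eq_zero_of_integral_of_smul_mem mem_integralH1_of_layerCores_eq_of_smul_mem

/-- The named Literature fact F2 `Kato2004.mem_pSmul_of_red_eq_zero`, DISCHARGED (alias of `stub_red` under the
`_holds` naming convention, Summits-side). [cite: Kato2004Asterisque, §13.8 (pp. 228–229)] -/
theorem mem_pSmul_of_red_eq_zero_holds : mem_pSmul_of_red_eq_zero := stub_red

end Summit.BirchSwinnertonDyer.BirchSwinnertonDyer.Rank1Residual.UniversalNorms

end
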